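import Summits.Ventures.YMGap.Thresholds.OneLinkEigenModulus
import HarnessLib

/-!
# Venture YMGap — the one-link modulus: the integration-by-parts term as a standalone lemma

HONEST FRAMING: venture file of the cell `pub-ymgap` (QuantumFields programme), strong-coupling LATTICE bookkeeping; nothing about
the continuum.  The curvature-free half of the first-order identity `Cov(φ,u) = (1/λ)(E Γ(φ,u) + Cov(φ, Γ(S,u)))`:
for `φ` bounded measurable `L`-Lipschitz on `SU(N)` and `u = Re tr(·Δ)`,
`|∫ φ · L_S u dν_B| ≤ L · ‖Δ‖_F` for EVERY `B` (no smallness): integration by parts `∫ F L_S u e^S = −∫ Γ(F,u) e^S` on smooth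
`ε`-approximants `F` of `φ` with `Γ(F,F) ≤ L²` (`exists_smooth_approx`) and `Γ(u,u) ≤ ‖Δ‖_F²` (`Gam_pot_one_self_le`).  This is
the block used verbatim inside `cov_linear_le`; it is isolated here for the refined covariance lemma (`OneLinkEigenRefined`).
-/

noncomputable section

open scoped Matrix ComplexConjugate BigOperators ContDiff Matrix.Norms.Frobenius
open Matrix Complex Finset MeasureTheory ProbabilityTheory
open Literature.MathematicalPhysics.QuantumFieldTheory
open Literature.MathematicalPhysics.QuantumFieldTheory.SUNBakryEmery
open Literature.MathematicalPhysics.QuantumFieldTheory.Balaban1983to89.StrongCouplingDobrushinWindow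
open Literature.MathematicalPhysics.QuantumFieldTheory.Balaban1983to89.StrongCouplingKernelWindow

namespace Summit.Ventures.YMGap.OneLinkEigen

variable {N : ℕ}

/-- **The integration-by-parts term**: `|∫ φ · L_S(Re tr(·Δ)) dν_B| ≤ L ‖Δ‖_F` for every `B`, `φ` bounded measurable
`L`-Lipschitz (`S = N Re tr(·B)`, `ν_B ∝ e^S dg`). [folklore] -/
theorem abs_integral_mul_genL_le (hN : 2 ≤ N) (B Δ : Matrix (Fin N) (Fin N) ℂ) (φ : SUN N → ℝ) {L : ℝ}
    (hφm : Measurable φ) (hφb : ∃ C, ∀ s, |φ s| ≤ C) (hL : 0 ≤ L) (hφL : ∀ a b, |φ a - φ b| ≤ L * suFrobDist a b) :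
    |∫ g, φ g * genL (pot (N : ℝ) B) (pot 1 Δ) g
        ∂(haarProbability (SUN N)).tilted (fun g => (N : ℝ) * ((g : Matrix (Fin N) (Fin N) ℂ) * B).trace.re)| ≤
      L * frobNorm Δ := by
  have hN0 : N ≠ 0 := by omega
  set S : Matrix (Fin N) (Fin N) ℂ → ℝ := pot (N : ℝ) B with hSdef
  set u : Matrix (Fin N) (Fin N) ℂ → ℝ := pot 1 Δ with hudef
  have hS : ContDiff ℝ ∞ S := contDiff_pot _ B
  have hu : ContDiff ℝ ∞ u := contDiff_pot _ Δ
  set ν : Measure (SUN N) :=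
    (haarProbability (SUN N)).tilted (fun g => (N : ℝ) * ((g : Matrix (Fin N) (Fin N) ℂ) * B).trace.re) with hν
  have hexpc : Continuous fun g : SUN N => Real.exp (S g) := Real.continuous_exp.comp (continuous_restrict hS)
  have hexpi : Integrable (fun g : SUN N => Real.exp ((N : ℝ) * ((g : Matrix (Fin N) (Fin N) ℂ) * B).trace.re))
      (haarProbability (SUN N)) := integrable_of_continuous_SUN hexpc _
  haveI : IsProbabilityMeasure ν := isProbabilityMeasure_tilted hexpi
  set Z : ℝ := ∫ g : SUN N, Real.exp (S g) ∂(haarSU N) with hZ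
  have hZpos : 0 < Z := integral_exp_pos (integrable_of_continuous_SUN hexpc _)
  have htilt : ∀ f : SUN N → ℝ, ∫ g, f g ∂ν = (∫ g : SUN N, Real.exp (S g) * f g ∂(haarSU N)) / Z := fun f => by
    rw [hν]; exact integral_tilted_eq_div _ f
  set Lg : SUN N → ℝ := fun g => genL S u g with hLg
  show |∫ g, φ g * Lg g ∂ν| ≤ L * frobNorm Δ
  have hLgc : Continuous Lg := continuous_restrict (contDiff_genL hS hu)
  have hφc : Continuous φ := continuous_of_lipschitz_suFrobDist hφL
  have mφ : MemLp φ 2 ν := by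
    obtain ⟨C, hC⟩ := hφb
    exact MemLp.of_bound hφm.aestronglyMeasurable C (ae_of_all _ fun g => (Real.norm_eq_abs _).le.trans (hC g))
  have mLg : MemLp Lg 2 ν := memLp_two_of_continuous hLgc ν
  obtain ⟨CL, hCL⟩ := exists_abs_le_of_continuous hLgc
  have hCL0 : 0 ≤ CL := (abs_nonneg _).trans (hCL 1)
  have hwint : ∀ {f : SUN N → ℝ}, Continuous f → Integrable (fun g : SUN N => Real.exp (S g) * f g) (haarSU N) :=
    fun hf => integrable_of_continuous_SUN (hexpc.mul hf) _
  refine le_of_forall_pos_le_add fun δ hδ => ?_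
  set ε : ℝ := δ / (CL + 1) with hε
  have hεpos : 0 < ε := div_pos hδ (by linarith)
  obtain ⟨F, hF, hΓF, hFφ⟩ := exists_smooth_approx hL hφL hεpos hN0
  have hFc : Continuous fun g : SUN N => F g := continuous_restrict hF
  have hFLg : ∫ g, F g * Lg g ∂ν = -(∫ g : SUN N, Real.exp (S g) * Gam F u g ∂(haarSU N)) / Z := by
    rw [htilt]
    congr 1
    have : (fun g : SUN N => Real.exp (S g) * (F g * Lg g)) = fun g : SUN N => F g * (Real.exp (S g) * genL S u g) := by
      funext g; simp only [hLg]; ring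
    rw [this, integral_mul_exp_mul_genL hN0 hS hF hu]
  have hΓFu : ∀ g : SUN N, |Gam F u g| ≤ L * frobNorm Δ := by
    intro g
    refine (abs_Gam_le F u g).trans ?_
    have h1 : Real.sqrt (Gam F F g) ≤ L := by
      rw [← Real.sqrt_sq hL]; exact Real.sqrt_le_sqrt (hΓF g)
    have h2 : Real.sqrt (Gam u u g) ≤ frobNorm Δ := by
      rw [← Real.sqrt_sq (frobNorm_nonneg Δ)]
      exact Real.sqrt_le_sqrt (by rw [hudef]; exact Gam_pot_one_self_le hN0 Δ g)
    exact mul_le_mul h1 h2 (Real.sqrt_nonneg _) hL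
  have hA : |∫ g, F g * Lg g ∂ν| ≤ L * frobNorm Δ := by
    rw [hFLg, abs_div, abs_neg, abs_of_pos hZpos, div_le_iff₀ hZpos]
    calc |∫ g : SUN N, Real.exp (S g) * Gam F u g ∂(haarSU N)|
        ≤ ∫ g : SUN N, |Real.exp (S g) * Gam F u g| ∂(haarSU N) := abs_integral_le_integral_abs
      _ ≤ ∫ g : SUN N, Real.exp (S g) * (L * frobNorm Δ) ∂(haarSU N) := by
          refine integral_mono (hwint (continuous_restrict (contDiff_Gam hF hu))).abs (hwint continuous_const)
            fun g => ?_
          rw [abs_mul, abs_of_pos (Real.exp_pos _)]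
          exact mul_le_mul_of_nonneg_left (hΓFu g) (Real.exp_pos _).le
      _ = L * frobNorm Δ * Z := by rw [integral_mul_const, hZ, mul_comm]
  have i1 : Integrable (fun g : SUN N => φ g * Lg g) ν := (mφ.integrable_mul mLg)
  have i2 : Integrable (fun g : SUN N => F g * Lg g) ν := ((memLp_two_of_continuous hFc ν).integrable_mul mLg)
  have hB' : |∫ g, φ g * Lg g ∂ν - ∫ g, F g * Lg g ∂ν| ≤ ε * CL := by
    rw [← integral_sub i1 i2]
    calc |∫ g, (φ g * Lg g - F g * Lg g) ∂ν| ≤ ∫ g, |φ g * Lg g - F g * Lg g| ∂ν := abs_integral_le_integral_abs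
      _ ≤ ∫ g, ε * CL ∂ν := by
          refine integral_mono (i1.sub i2).abs (integrable_const _) fun g => ?_
          rw [← sub_mul, abs_mul]
          refine mul_le_mul ?_ (hCL g) (abs_nonneg _) hεpos.le
          rw [abs_sub_comm]; exact hFφ g
      _ = ε * CL := by simp
  have hεCL : ε * CL ≤ δ := by
    rw [hε, div_mul_eq_mul_div, div_le_iff₀ (by linarith)]
    nlinarith
  calc |∫ g, φ g * Lg g ∂ν| = |(∫ g, φ g * Lg g ∂ν - ∫ g, F g * Lg g ∂ν) + ∫ g, F g * Lg g ∂ν| := by ring_nf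
    _ ≤ |∫ g, φ g * Lg g ∂ν - ∫ g, F g * Lg g ∂ν| + |∫ g, F g * Lg g ∂ν| := abs_add_le _ _
    _ ≤ δ + L * frobNorm Δ := add_le_add (hB'.trans hεCL) hA
    _ = L * frobNorm Δ + δ := add_comm _ _

end Summit.Ventures.YMGap.OneLinkEigen
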